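import Summits.HubbardSuperconductivity.HubbardSuperconductivity.Theorems.MesoscopicPairOrder.Negative.StonerMoments
import Summits.HubbardSuperconductivity.HubbardSuperconductivity.Theorems.MesoscopicPairOrder.Negative.StonerSquareSea
import Mathlib.Analysis.Real.Pi.Bounds
import HarnessLib

/-!
# Crux `MesoscopicPairOrder` (stmt-HubbardSuperconductivity-7331), Negative side:
# NO NEARLY SATURATED FERROMAGNETISM AT WEAK COUPLING — the spin deficiency is `≥ L²/200`

Line `redirect_birth` (lead c9). The refuter instruments `PolarisedExclusion.pointwise_false_of_nearlySaturated`
(against the crux body) and `FluctuationFloorPosition.fluctuationFloorAt_false_of_nearlySaturated` (against stub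
(Q)) fire at a point `(U, δ)` where NEARLY SATURATED sector ground states occur infinitely often (spin deficiency
`n - S ≤ κL²` for every `κ > 0`). Here that hypothesis is REFUTED on the weak-coupling part of the box:

* `spinDeficiency_ge_of_weakCoupling` — for `0 ≤ U ≤ 1/2`, `δ ∈ [1/10, 3/10]` and EVERY `L ≥ 1000`, every
  ground state `ψ` of the `(2n, S^z = 0)` sector (`n = ⌊(1-δ)L²/2⌋`) of `hubbardTorus 2 L 1 U` with
  `S² ψ = S(S+1) ψ`, `S ≤ n`, has `n - S ≥ L²/200`: the total spin of every ground multiplet misses saturation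
  by an EXTENSIVE amount. Proof: the sharpened Stoner ceiling `4S ≤ 4n + L² + 2Σ_T ε + U n`
  (`four_spin_le_of_pairedSea`) with the trial momentum set `T` of `exists_trialSet_card_eq` on the largest
  centred odd square `m × m`, `m² ≤ n < (m+2)²` (`exists_odd_sq_le_lt`): `0.5916 L - 3 < m < 0.6709 L`, so
  `sin(mπ/L) = cos(mπ/L - π/2) ≥ cos(0.1709π) ≥ 1 - (0.1709π)²/2 ≥ 0.855`, and
  `4(n - S) ≥ -L² + (8/π)·0.855·(0.5916L - 3)L - 8(4L + 3) - 0.225 L² ≥ 0.063 L² - 38.6 L - 24 ≥ L²/50`.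
* `not_nearlySaturated_frequently_of_weakCoupling` — hence the near-saturation hypothesis of both refuter
  instruments fails at every `(U, δ) ∈ [0, 1/2] × [1/10, 3/10]` (they cannot fire there); this extends the
  single-spin-flip exclusion of FULL saturation (`NoSaturationEnvelope`, an `O(1)` gain) to an `O(L²)` one at
  weak coupling. Stub (Q)'s necessary condition `spinDeficiency_ge_of_fluctuationFloorAt` is thereby met on
  that part of the box with room to spare; nothing here bears on (Q) itself (a floor on pair FLUCTUATIONS).

Sources: E. C. Stoner, Proc. R. Soc. A 165 (1938) 372; H. Tasaki, Prog. Theor. Phys. 99 (1998) 489, §5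
(variational arguments against ferromagnetism at weak coupling / low density); E. H. Lieb, PRL 62 (1989)
1201. Folklore finite-dimensional statements; no definition, no named fact.
-/

noncomputable section

-- the summit namespace repeats the problem name by design (D-0017)
set_option linter.dupNamespace false

namespace Summit.HubbardSuperconductivity.HubbardSuperconductivity.Theorems.MesoscopicPairOrder.Negative

open Matrix Finset Filter
open Literature.Probability.LatticeModels Literature.MathematicalPhysics.QuantumLattice
open scoped ComplexOrder ComplexConjugate

/-- **`sin(π s) ≥ 0.855` for `1/2 ≤ s ≤ 0.6709`** (`sin(πs) = cos(π(s - 1/2))`, `cos` decreasing on `[0, π]`,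
`cos y ≥ 1 - y²/2`, `π < 3.141593`). The side ratios `s = m/L` of the trial squares lie in this range. [folklore] -/
theorem sin_pi_mul_ge {s : ℝ} (hs1 : 1 / 2 ≤ s) (hs2 : s ≤ 0.6709) : 0.855 ≤ Real.sin (Real.pi * s) := by
  have hπ := Real.pi_pos
  have hπ3 := Real.pi_lt_d6
  rw [← Real.cos_sub_pi_div_two]
  have hx0 : 0 ≤ Real.pi * s - Real.pi / 2 := by nlinarith
  have hxy : Real.pi * s - Real.pi / 2 ≤ Real.pi * 0.1709 := by nlinarith
  have hyπ : Real.pi * 0.1709 ≤ Real.pi := by nlinarith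
  have h1 : Real.cos (Real.pi * 0.1709) ≤ Real.cos (Real.pi * s - Real.pi / 2) :=
    Real.cos_le_cos_of_nonneg_of_le_pi hx0 hyπ hxy
  have h2 : 1 - (Real.pi * 0.1709) ^ 2 / 2 ≤ Real.cos (Real.pi * 0.1709) := Real.one_sub_sq_div_two_le_cos
  have h3 : (Real.pi * 0.1709) ^ 2 ≤ (3.141593 * 0.1709) ^ 2 :=
    pow_le_pow_left₀ (by positivity) (by nlinarith) 2
  nlinarith

/-- Side ratio of the largest centred odd square inside the Fermi area (pure arithmetic): if `m² ≤ n < (m+2)²`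
with `0.35 L² - 1 ≤ n ≤ 0.45 L²` and `L ≥ 1000`, then `0.5916 L - 3 < m < 0.6709 L`. [folklore] -/
theorem square_side_bounds {L m n : ℝ} (hL : 1000 ≤ L) (hm0 : 0 ≤ m) (h1 : m ^ 2 ≤ n) (h2 : n < (m + 2) ^ 2)
    (hn1 : n ≤ 0.45 * L ^ 2) (hn2 : 0.35 * L ^ 2 - 1 ≤ n) :
    0.5916 * L - 3 < m ∧ m < 0.6709 * L := by
  have hLpos : 0 < L := by linarith
  constructor
  · have hsq : (0.5916 * L - 1) ^ 2 ≤ 0.35 * L ^ 2 - 1 := by nlinarith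
    have hlt : (0.5916 * L - 1) ^ 2 < (m + 2) ^ 2 := by linarith
    have := lt_of_pow_lt_pow_left₀ 2 (by positivity) hlt
    linarith
  · have hlt : m ^ 2 < (0.6709 * L) ^ 2 := by nlinarith
    exact lt_of_pow_lt_pow_left₀ 2 (by positivity) hlt

/-- The final bookkeeping of the Stoner bound (pure arithmetic): the spin ceiling `4S ≤ 4n + L² + 2Σ + U n`, the
trial-set bound `Σ ≤ -4AB + 4·sur` with `AB ≥ 0.855 (0.5916 L - 3) L / 3.141593`, `sur ≤ 4L + 3`, `U ≤ 1/2`,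
`n ≤ 0.45 L²` and `L ≥ 1000` give `L²/200 ≤ n - S`. [folklore] -/
theorem deficiency_arith {L n S T A B sur U : ℝ} (hL : 1000 ≤ L) (hU0 : 0 ≤ U) (hU1 : U ≤ 1 / 2)
    (hn : n ≤ 0.45 * L ^ 2) (hstoner : 4 * S ≤ 4 * n + L ^ 2 + 2 * T + U * n)
    (hT : T ≤ -4 * A * B + 4 * sur) (hM : 0.855 * (0.5916 * L - 3) * (L * (1 / 3.141593)) ≤ A * B)
    (hsur : sur ≤ 4 * L + 3) : L ^ 2 / 200 ≤ n - S := by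
  have hLpos : 0 < L := by linarith
  have hUn : U * n ≤ 0.225 * L ^ 2 := by nlinarith
  have hLL : 1000 * L ≤ L ^ 2 := by nlinarith
  have hT' : T ≤ -4 * (A * B) + 4 * sur := by linarith
  nlinarith [hstoner, hT', hM, hsur, hUn, hLL]

/-- **EXTENSIVE SPIN DEFICIENCY AT WEAK COUPLING.** For `0 ≤ U ≤ 1/2`, `δ ∈ [1/10, 3/10]`, every `L ≥ 1000`
and every ground state `ψ` of the `(2n, S^z = 0)` sector (`n = ⌊(1-δ)L²/2⌋`) of `hubbardTorus 2 L 1 U` with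
`S² ψ = S(S+1) ψ`, `S ≤ n`:  `L²/200 ≤ n - S`. (Stoner criterion with the centred-square paired Fermi sea;
see the module docstring for the constants.) Stoner (1938); Tasaki (1998) §5. [folklore] -/
theorem spinDeficiency_ge_of_weakCoupling {U δ : ℝ} (hU : U ∈ Set.Icc (0:ℝ) (1 / 2))
    (hδ : δ ∈ Set.Icc (1 / 10 : ℝ) (3 / 10)) {L : ℕ} [NeZero L] (hL : 1000 ≤ L)
    {ψ : Fock (Orb (FermionTorus 2 L))}
    (hgs : IsGroundStateInSector (hubbardTorus 2 L 1 U) (2 * ⌊(1 - δ) * (L : ℝ) ^ 2 / 2⌋₊) 0 ψ)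
    {S : ℕ} (hS : S ≤ ⌊(1 - δ) * (L : ℝ) ^ 2 / 2⌋₊)
    (hspin : spinSq *ᵥ ψ = (((S : ℝ) * ((S : ℝ) + 1) : ℝ) : ℂ) • ψ) :
    (L : ℝ) ^ 2 / 200 ≤ ((⌊(1 - δ) * (L : ℝ) ^ 2 / 2⌋₊ - S : ℕ) : ℝ) := by
  obtain ⟨hU0, hU1⟩ := hU
  obtain ⟨hδ1, hδ2⟩ := hδ
  set n : ℕ := ⌊(1 - δ) * (L : ℝ) ^ 2 / 2⌋₊ with hn_def
  have hL3 : 3 ≤ L := le_trans (by norm_num) hL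
  have hLr : (1000 : ℝ) ≤ L := by exact_mod_cast hL
  have hLpos : (0 : ℝ) < L := by linarith
  -- the filling `n` in real terms
  have hx0 : 0 ≤ (1 - δ) * (L : ℝ) ^ 2 / 2 := by
    have : 0 ≤ 1 - δ := by linarith
    positivity
  have hn_le : (n : ℝ) ≤ (1 - δ) * (L : ℝ) ^ 2 / 2 := Nat.floor_le hx0
  have hn_ge : (1 - δ) * (L : ℝ) ^ 2 / 2 - 1 ≤ (n : ℝ) := by
    have := Nat.lt_floor_add_one ((1 - δ) * (L : ℝ) ^ 2 / 2)
    linarith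
  have hn_le' : (n : ℝ) ≤ 0.45 * (L : ℝ) ^ 2 := by nlinarith
  have hn_ge' : 0.35 * (L : ℝ) ^ 2 - 1 ≤ (n : ℝ) := by nlinarith
  have hn1 : 1 ≤ n := by
    have : (1 : ℝ) ≤ (n : ℝ) := by nlinarith
    exact_mod_cast this
  have hnL : n ≤ L ^ 2 := by
    have : (n : ℝ) ≤ (L : ℝ) ^ 2 := by nlinarith
    exact_mod_cast this
  -- the largest centred odd square inside the Fermi area
  obtain ⟨h, hm1, hm2⟩ := exists_odd_sq_le_lt hn1
  set m : ℕ := 2 * h + 1 with hm_def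
  have hm2' : n < (m + 2) ^ 2 := by
    rw [show m + 2 = 2 * h + 3 by omega]
    exact hm2
  have hmr1 : ((m : ℝ)) ^ 2 ≤ (n : ℝ) := by exact_mod_cast hm1
  have hmr2 : (n : ℝ) < ((m : ℝ) + 2) ^ 2 := by exact_mod_cast hm2'
  have hm_pos : (0 : ℝ) ≤ (m : ℝ) := by positivity
  -- `0.5916 L - 3 < m < 0.6709 L`
  obtain ⟨hm_lo, hm_hi⟩ := square_side_bounds hLr hm_pos hmr1 hmr2 hn_le' hn_ge'
  have hmL : m ≤ L := by
    have : (m : ℝ) ≤ L := by linarith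
    exact_mod_cast this
  -- the trial set and the Stoner ceiling
  obtain ⟨T, hTcard, hTsum⟩ := exists_trialSet_card_eq hL3 h (by simpa [hm_def] using hmL) hm1 hnL
  have hl : T.toList.Nodup := Finset.nodup_toList T
  have hlen : T.toList.length = n := by rw [Finset.length_toList, hTcard]
  have hstoner := four_spin_le_of_pairedSea hL3 hU0 hS hgs hspin hl hlen
  rw [Finset.toList_toFinset] at hstoner
  -- the sine at the square's side ratio
  have hsin : 0.855 ≤ Real.sin ((2 * h + 1 : ℕ) * Real.pi / L) := by
    have e : ((2 * h + 1 : ℕ) : ℝ) * Real.pi / L = Real.pi * ((m : ℝ) / L) := by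
      rw [hm_def]; field_simp
    rw [e]
    apply sin_pi_mul_ge
    · rw [le_div_iff₀ hLpos]; linarith
    · rw [div_le_iff₀ hLpos]; linarith
  -- `8 m (L/π) sin ≥ 8 · 0.855 · (1/3.141593) · (0.5916 L - 3) L`
  have hπ := Real.pi_pos
  have hπ3 := Real.pi_lt_d6
  have hkey : 0.855 * (0.5916 * (L : ℝ) - 3) * ((L : ℝ) * (1 / 3.141593)) ≤
      ((2 * h + 1 : ℕ) : ℝ) * ((L : ℝ) / Real.pi * Real.sin ((2 * h + 1 : ℕ) * Real.pi / L)) := by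
    have e1 : ((2 * h + 1 : ℕ) : ℝ) = (m : ℝ) := by rw [hm_def]
    rw [e1]
    have hA : 0.5916 * (L : ℝ) - 3 ≤ (m : ℝ) := hm_lo.le
    have hA0 : 0 ≤ 0.5916 * (L : ℝ) - 3 := by nlinarith
    have hB : (L : ℝ) * (1 / 3.141593) ≤ (L : ℝ) / Real.pi := by
      have hinv : (1 : ℝ) / 3.141593 ≤ 1 / Real.pi := one_div_le_one_div_of_le hπ hπ3.le
      calc (L : ℝ) * (1 / 3.141593) ≤ (L : ℝ) * (1 / Real.pi) := mul_le_mul_of_nonneg_left hinv hLpos.le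
        _ = (L : ℝ) / Real.pi := by ring
    have hB0 : 0 ≤ (L : ℝ) * (1 / 3.141593) := by positivity
    have hC0 : (0 : ℝ) ≤ 0.855 := by norm_num
    calc 0.855 * (0.5916 * (L : ℝ) - 3) * ((L : ℝ) * (1 / 3.141593))
        = (0.5916 * (L : ℝ) - 3) * (((L : ℝ) * (1 / 3.141593)) * 0.855) := by ring
      _ ≤ (m : ℝ) * (((L : ℝ) / Real.pi) * Real.sin ((2 * h + 1 : ℕ) * Real.pi / L)) := by
          apply mul_le_mul hA _ (by positivity) hm_pos
          exact mul_le_mul hB hsin hC0 (by positivity)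
      _ = (m : ℝ) * ((L : ℝ) / Real.pi * Real.sin ((2 * h + 1 : ℕ) * Real.pi / L)) := by ring
  -- the surplus momenta: `n - m² ≤ 4m + 3 ≤ 4L + 3`
  have hsur : ((n - (2 * h + 1) ^ 2 : ℕ) : ℝ) ≤ 4 * (L : ℝ) + 3 := by
    have h1 : n - (2 * h + 1) ^ 2 ≤ 4 * L + 3 := by
      have h2 : n < (2 * h + 1) ^ 2 + 4 * (2 * h + 1) + 4 := by
        have e : (2 * h + 3) ^ 2 = (2 * h + 1) ^ 2 + 4 * (2 * h + 1) + 4 := by ring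
        rw [← e]
        exact hm2
      have h3 : 2 * h + 1 ≤ L := by simpa [hm_def] using hmL
      omega
    exact_mod_cast h1
  -- assemble: `4(n - S) ≥ -L² + 8 m (L/π) sin - 8(n - m²) - U n ≥ L²/50`
  rw [Nat.cast_sub hS]
  exact deficiency_arith hLr hU0 hU1 hn_le' hstoner hTsum hkey hsur

/-- **The near-saturation refuter hypothesis fails at weak coupling.** For `(U, δ) ∈ [0, 1/2] × [1/10, 3/10]` it
is NOT the case that for every `κ > 0` nearly saturated sector ground states (`n - S ≤ κL²`) occur along
infinitely many even sides: with `κ = 1/400`, any such side `L ≥ 1000` contradicts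
`spinDeficiency_ge_of_weakCoupling`. So `pointwise_false_of_nearlySaturated` and
`fluctuationFloorAt_false_of_nearlySaturated` cannot fire on that part of the box. [folklore] -/
theorem not_nearlySaturated_frequently_of_weakCoupling {U δ : ℝ} (hU : U ∈ Set.Icc (0:ℝ) (1 / 2))
    (hδ : δ ∈ Set.Icc (1 / 10 : ℝ) (3 / 10)) :
    ¬ ∀ κ : ℝ, 0 < κ → ∃ᶠ L : ℕ in atTop, Even L ∧
      ∃ (ψ : Fock (Orb (FermionTorus 2 L))) (S : ℕ), S ≤ ⌊(1 - δ) * (L : ℝ) ^ 2 / 2⌋₊ ∧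
        IsGroundStateInSector (hubbardTorus 2 L 1 U) (2 * ⌊(1 - δ) * (L : ℝ) ^ 2 / 2⌋₊) 0 ψ ∧
          spinSq *ᵥ ψ = (((S : ℝ) * ((S : ℝ) + 1) : ℝ) : ℂ) • ψ ∧
            ((⌊(1 - δ) * (L : ℝ) ^ 2 / 2⌋₊ - S : ℕ) : ℝ) ≤ κ * (L : ℝ) ^ 2 := by
  intro hns
  obtain ⟨L, ⟨-, ψ, S, hS, hgs, hspin, hdef⟩, hLge⟩ :=
    ((hns (1 / 400) (by norm_num)).and_eventually (eventually_ge_atTop 1000)).exists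
  haveI : NeZero L := ⟨by omega⟩
  have h := spinDeficiency_ge_of_weakCoupling hU hδ hLge hgs hS hspin
  have hLpos : (0 : ℝ) < L := by exact_mod_cast (show 0 < L by omega)
  nlinarith [sq_nonneg (L : ℝ), mul_pos hLpos hLpos]

/-- Registered sub-goal form (line `redirect_birth`, lead c9): the near-saturation refuter hypothesis fails on
`[0, 1/2] × [1/10, 3/10]` (`not_nearlySaturated_frequently_of_weakCoupling`). [folklore] -/
theorem notNearlySaturatedFrequentlyOfWeakCoupling : ∀ {U δ : ℝ}, U ∈ Set.Icc (0:ℝ) (1 / 2) → δ ∈ Set.Icc (1 / 10 : ℝ) (3 / 10) → ¬ ∀ κ : ℝ, 0 < κ → ∃ᶠ L : ℕ in Filter.atTop, Even L ∧ ∃ (ψ : Fock (Orb (FermionTorus 2 L))) (S : ℕ), S ≤ ⌊(1 - δ) * (L : ℝ) ^ 2 / 2⌋₊ ∧ IsGroundStateInSector (hubbardTorus 2 L 1 U) (2 * ⌊(1 - δ) * (L : ℝ) ^ 2 / 2⌋₊) 0 ψ ∧ spinSq *ᵥ ψ = (((S : ℝ) * ((S : ℝ) + 1) : ℝ) : ℂ)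 • ψ ∧ ((⌊(1 - δ) * (L : ℝ) ^ 2 / 2⌋₊ - S : ℕ) : ℝ) ≤ κ * (L : ℝ) ^ 2 :=
  fun hU hδ => not_nearlySaturated_frequently_of_weakCoupling hU hδ

end Summit.HubbardSuperconductivity.HubbardSuperconductivity.Theorems.MesoscopicPairOrder.Negative
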